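import Summits.ResolutionOfSingularities.ResolutionOfSingularities.Theses.UniversalCells
import Summits.ResolutionOfSingularities.ResolutionOfSingularities.Theorems.UniversalCellsLocalToGlobalExtension
import Literature.AlgebraicGeometry.Resolution.PrincipalizationToResolution
import Mathlib.Topology.KrullDimension
import HarnessLib

/-!
# Route UniversalCells — crux `LocalToGlobal` (stmt-ResolutionOfSingularities-15232):
# the DIMENSION SPLIT `OpenPatchingDimLeFour → LocalToGlobalDimGeFive → LocalToGlobal`

Crux-strategist decomposition (STRATEGY-CENSUS.md of the crux directory
`Cruxes/LocalToGlobal/`; glue authored by the strategist seat `planner-cstrat-…-15232-b1-0` as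
`Cruxes/LocalToGlobal/SplitGlue.lean`, landed by the line lead c1 as the composition of skeleton
`birth` v3). The crux is, prime by prime, `H_p → R_p`: pointwise Zariski-local
resolvability of every integral separated finite-type `𝔽_p`-scheme implies a resolution of every
such scheme. By the lead's no-slack certificates (`localToGlobal_iff_openPatching`,
`localToGlobal_iff_twoModelPatchingAt`, `Theorems/UniversalCellsLocalToGlobalReductions.lean`) its
residue is Zariski's two-model patching over `𝔽_p`, open in dimension `≥ 4` and carried one
dimension up by every known engine from dimension `5` on; dimension `4` is the one slice where the
catalogued engines (Cossart–Piltant 2019 at non-closed points + one punctual dimension-4 atom) bite.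
The split isolates that slice as an `H_p`-FREE open-patching statement:

* `OpenPatchingDimLeFour` (child 1): for `X` integral separated of finite type over `𝔽_p` of
  (topological Krull) dimension `≤ 4`, covered by opens `U ∪ V = X`, two proper birational
  INTEGRAL models `Z₁ → X` regular over `U` and `Z₂ → X` regular over `V` patch to a resolution of
  `X` (Zariski 1944 Fundamental Theorem / Piltant 2013 Prop. 5.1 in its Zariski-open form, first
  open dimension; implied by the summit at `p`).
* `LocalToGlobalDimGeFive` (child 2): the crux verbatim for `X` of dimension `> 4` (it carries the
  crux's difficulty from dimension `5` on; to be parked).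
* `LocalToGlobal_of_subs : OpenPatchingDimLeFour → LocalToGlobalDimGeFive → LocalToGlobal`
  (PROVED here): case split on `topologicalKrullDim X ≤ 4`; in dimension `≤ 4`, the finite-cover
  induction of `Theorems.stub_coverInduction` re-run with the dimension bound threaded through the
  open subschemes `U₁ ∪ ⋯ ∪ U_k ↪ X` (`dim ≤ dim X`, `Topology.IsInducing.topologicalKrullDim_le`),
  its binary-union step supplied by child 1 after extending the two local resolutions to partial
  resolutions of the ambient open (`Theorems.stub_extension`, Nagata — a theorem of the tree).

Both children are stated inline (no new definitions), in the vocabulary of the crux.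
-/

-- single-problem summit: the doubled namespace component `ResolutionOfSingularities` is forced
set_option linter.dupNamespace false

noncomputable section

namespace Summit.ResolutionOfSingularities.ResolutionOfSingularities.Theorems

open CategoryTheory AlgebraicGeometry TopologicalSpace Topology
open Literature.AlgebraicGeometry.Resolution
open Summit.ResolutionOfSingularities.ResolutionOfSingularities.Theses.UniversalCells (LocalToGlobal)

/-- **Finite-cover induction below a dimension bound.** For a prime `p` and a bound `n`: if every
point of every integral separated finite-type `𝔽_p`-scheme has a resolvable open neighbourhood
(`hloc`), and binary unions of resolvable opens are resolvable for such schemes of dimension `≤ n`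
(`hbin`), then every such scheme of dimension `≤ n` has a resolution. Same proof as
`Theorems.stub_coverInduction` (finite subcover, `Finset.Nonempty.cons_induction`), the bound
passing to the open subschemes `U a ∪ ⋃_{x ∈ t} U x ↪ X` because the topological Krull dimension
does not increase along an inducing map. [cite: Hu2021, p. 65] -/
theorem hasResolution_of_binaryUnion_of_dim_le (p : ℕ) (hp : p.Prime) (n : WithBot ℕ∞)
    (hloc : ∀ (X : Scheme.{0}) (f : X ⟶ Spec (.of (ZMod p))), IsSeparated f →
      LocallyOfFiniteType f → QuasiCompact f → IsIntegral X →
        ∀ x : X, ∃ U : X.Opens, x ∈ U ∧ Scheme.HasResolution (U : Scheme.{0}))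
    (hbin : ∀ (X : Scheme.{0}) (f : X ⟶ Spec (.of (ZMod p))), IsSeparated f →
      LocallyOfFiniteType f → QuasiCompact f → IsIntegral X → topologicalKrullDim X ≤ n →
        ∀ U V : X.Opens, U ⊔ V = ⊤ →
          Scheme.HasResolution (U : Scheme.{0}) → Scheme.HasResolution (V : Scheme.{0}) →
            Scheme.HasResolution X)
    (X : Scheme.{0}) (f : X ⟶ Spec (.of (ZMod p))) (hs : IsSeparated f)
    (hl : LocallyOfFiniteType f) (hq : QuasiCompact f) (hi : IsIntegral X)
    (hX : topologicalKrullDim X ≤ n) :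
    Scheme.HasResolution X := by
  haveI : Fact p.Prime := ⟨hp⟩
  haveI : IsLocallyNoetherian X := LocallyOfFiniteType.isLocallyNoetherian f
  haveI : CompactSpace X := QuasiCompact.compactSpace_of_compactSpace f
  -- Step 1: a resolvable open neighbourhood `U x` of every point `x`.
  choose U hxU hU using fun x => hloc X f hs hl hq hi x
  -- Step 2: every nonempty finite union of the `U x` is resolvable.
  have key : ∀ s : Finset X, s.Nonempty →
      Scheme.HasResolution ((s.sup U : X.Opens) : Scheme.{0}) := by
    intro s hsne
    induction hsne using Finset.Nonempty.cons_induction with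
    | singleton a =>
      rw [Finset.sup_singleton]
      exact hU a
    | cons a t hat htne ih =>
      rw [Finset.sup_cons]
      have haW : a ∈ U a ⊔ t.sup U := Opens.mem_sup.2 (Or.inl (hxU a))
      haveI : Nonempty ((U a ⊔ t.sup U : X.Opens) : Scheme.{0}) :=
        (Scheme.Opens.nonempty_iff _).2 ⟨a, haW⟩
      haveI : IsIntegral ((U a ⊔ t.sup U : X.Opens) : Scheme.{0}) :=
        isIntegral_of_isOpenImmersion (U a ⊔ t.sup U).ι
      have hcov : (U a ⊔ t.sup U).ι ⁻¹ᵁ U a ⊔ (U a ⊔ t.sup U).ι ⁻¹ᵁ t.sup U = ⊤ := by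
        rw [← Scheme.Hom.preimage_sup]
        exact (U a ⊔ t.sup U).ι_preimage_self
      -- the dimension bound passes to the open subscheme
      have hdimW : topologicalKrullDim ((U a ⊔ t.sup U : X.Opens) : Scheme.{0}) ≤ n :=
        ((U a ⊔ t.sup U).ι.isOpenEmbedding.isInducing.topologicalKrullDim_le).trans hX
      exact hbin _ ((U a ⊔ t.sup U).ι ≫ f) inferInstance inferInstance inferInstance
        inferInstance hdimW _ _ hcov
        ((hU a).of_isOpenImmersion ((U a ⊔ t.sup U).ι ∣_ U a))
        (ih.of_isOpenImmersion ((U a ⊔ t.sup U).ι ∣_ t.sup U))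
  -- Step 3: finitely many of the `U x` cover `X`.
  obtain ⟨t, ht⟩ := isCompact_univ.elim_finite_subcover (fun x => ((U x : X.Opens) : Set X))
    (fun x => (U x).isOpen) (fun x _ => Set.mem_iUnion.2 ⟨x, hxU x⟩)
  have htop : t.sup U = ⊤ := by
    refine top_le_iff.mp fun z _ => ?_
    obtain ⟨i, hi, hzi⟩ := Set.mem_iUnion₂.mp (ht (Set.mem_univ z))
    exact (Finset.le_sup hi : U i ≤ t.sup U) hzi
  have htne : t.Nonempty := by
    obtain ⟨x₀⟩ := (inferInstance : Nonempty X)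
    obtain ⟨i, hi, -⟩ := Set.mem_iUnion₂.mp (ht (Set.mem_univ x₀))
    exact ⟨i, hi⟩
  -- Step 4: `⊤ ≅ X`.
  have hres := key t htne
  rw [htop] at hres
  exact hres.of_iso X.topIso.hom

/-- **The dimension split of the crux `UniversalCells.LocalToGlobal`** (crux-strategist
decomposition, STRATEGY-CENSUS.md): Zariski-open patching of two partial resolutions over `𝔽_p`
in dimension `≤ 4` (child `OpenPatchingDimLeFour`, stated without the crux's antecedent) and the
crux restricted to dimension `> 4` (child `LocalToGlobalDimGeFive`) imply the crux. In dimension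
`≤ 4` the antecedent `H_p` is consumed exactly once, to cover `X` by finitely many resolvable
opens (`hasResolution_of_binaryUnion_of_dim_le`); the binary-union step extends the two local
resolutions to partial resolutions of the ambient open (`Theorems.stub_extension`: Nagata
compactification + closure of the graph, a theorem of the tree) and patches them by child 1.
[cite: Zariski1944, p. 539; Piltant2013, Prop. 5.1 and p. 2; Hu2021, p. 65] -/
theorem LocalToGlobal_of_subs
    (h₁ : ∀ p : ℕ, p.Prime → ∀ (X : AlgebraicGeometry.Scheme.{0})
      (f : X ⟶ AlgebraicGeometry.Spec (.of (ZMod p))), AlgebraicGeometry.IsSeparated f →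
      AlgebraicGeometry.LocallyOfFiniteType f → AlgebraicGeometry.QuasiCompact f →
      AlgebraicGeometry.IsIntegral X → topologicalKrullDim X ≤ 4 → ∀ U V : X.Opens, U ⊔ V = ⊤ →
      (∃ (Z : AlgebraicGeometry.Scheme.{0}) (π : Z ⟶ X), AlgebraicGeometry.IsIntegral Z ∧
        AlgebraicGeometry.IsProper π ∧ Literature.AlgebraicGeometry.Resolution.IsBirational π ∧
        ∀ z : Z, π.base z ∈ U → IsRegularLocalRing (Z.presheaf.stalk z)) →
      (∃ (Z : AlgebraicGeometry.Scheme.{0}) (π : Z ⟶ X), AlgebraicGeometry.IsIntegral Z ∧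
        AlgebraicGeometry.IsProper π ∧ Literature.AlgebraicGeometry.Resolution.IsBirational π ∧
        ∀ z : Z, π.base z ∈ V → IsRegularLocalRing (Z.presheaf.stalk z)) →
      Literature.AlgebraicGeometry.Resolution.Scheme.HasResolution X)
    (h₂ : ∀ p : ℕ, p.Prime → (∀ (X : AlgebraicGeometry.Scheme.{0})
      (f : X ⟶ AlgebraicGeometry.Spec (.of (ZMod p))), AlgebraicGeometry.IsSeparated f →
      AlgebraicGeometry.LocallyOfFiniteType f → AlgebraicGeometry.QuasiCompact f →
      AlgebraicGeometry.IsIntegral X → ∀ x : X, ∃ U : X.Opens, x ∈ U ∧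
        Literature.AlgebraicGeometry.Resolution.Scheme.HasResolution
          (U : AlgebraicGeometry.Scheme.{0})) →
      ∀ (X : AlgebraicGeometry.Scheme.{0}) (f : X ⟶ AlgebraicGeometry.Spec (.of (ZMod p))),
      AlgebraicGeometry.IsSeparated f → AlgebraicGeometry.LocallyOfFiniteType f →
      AlgebraicGeometry.QuasiCompact f → AlgebraicGeometry.IsIntegral X →
      ¬ topologicalKrullDim X ≤ 4 → Literature.AlgebraicGeometry.Resolution.Scheme.HasResolution X) :
    LocalToGlobal := by
  intro p hp hloc X f hs hl hq hi
  by_cases h4 : topologicalKrullDim X ≤ 4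
  · -- dimension ≤ 4: cover induction with the bound, binary unions from extension + child 1
    refine hasResolution_of_binaryUnion_of_dim_le p hp 4 hloc ?_ X f hs hl hq hi h4
    intro Y g hs' hl' hq' hi' hY U V hUV hU hV
    exact h₁ p hp Y g hs' hl' hq' hi' hY U V hUV (stub_extension p hp Y g hs' hl' hq' hi' U hU)
      (stub_extension p hp Y g hs' hl' hq' hi' V hV)
  · -- dimension > 4: child 2 is the crux there
    exact h₂ p hp hloc X f hs hl hq hi h4

end Summit.ResolutionOfSingularities.ResolutionOfSingularities.Theorems

end
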